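import Summits.NavierStokesRegularity.OSWSelfSimilar.SheetRPerturbedResolventIdentityC
import Summits.NavierStokesRegularity.OSWSelfSimilar.SheetRAssemblyOperators
import HarnessLib

/-!
# SHEET-ℝ: (P8) of the Z3-SR-SPEC spectral certificate — the `Ω* − Ω̄` PERTURBATION BOOKKEEPING in the kernel:
# Gårding-datum transfer and the cross-`K` second resolvent identity under a bounded perturbation `K ↦ K + B`,
# and the sheet's own `B = D²G(Ω̄)[u, ·]` with `‖B‖ ≤ (L_lip/2)‖u‖_E`

HONEST FRAMING (cell ns-blowup GROUP B / zone Z3, case Z3-SR-SPEC, PAPER item (P8) «the `Ω* − Ω̄` perturbation bookkeeping with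
`Δ = L_lip·rE♯₂`» of PREREG-SHEET-R-SPEC P4 / `CertificateViscousSheetRSpectrum` §1–§2; 1-D MODEL certificate frame (viscous gCLM/OSW
sheet on the line); not Euler/NS; «violates: none — MODEL»). Nothing here asserts that a profile exists; the Gårding datum at the
CENTRE (`GardingDataKC … K … c m`, cert-1's (S1) with `K = −P + F`, `c = c₂`, `m = c₁ + γ`) is the HYPOTHESIS, as in selfsim's files.

WHAT (P8) SAYS. The certificate is computed at the numerical centre `Ω̄`; the word is about the certified zero `Ω* = Ω̄ + u`,
`‖u‖_E ≤ rE♯₂`. Since `G` is quadratic, `DG(Ω̄ + u) − DG(Ω̄) = D²G[u, ·] =: B_u` is the SYMMETRISED quadratic part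
`δ ↦ (a𝒰_u δ′ − (Hu)δ) + (a𝒰_δ u′ − (Hδ)u)`, a bounded operator `E → L²_w` with `‖B_u‖ ≤ 2M_w‖u‖_E ≤ (L_lip/2)‖u‖_E`
(PRICE-impl1 (C4); selfsim's `Qop` and `four_Mw_le_Llip`). So `A*_F := DG(Ω*) + F = (−∂² + d∂ + V) + (K + B_u)` with the SAME
drift/potential of record and the perturbation moved into `K`. This file proves, in selfsim's architecture:
* §1 **Gårding transfer** (`gardingDataKC_add_of_lower`, `gardingDataKC_add_of_norm_le`): a datum `(c, m)` for `K` and `‖B‖ ≤ b`,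
  `2b < c` give a datum `(c − 2b, m − b/2)` for `K + B` — with `b = Δ/2` exactly the row's «`q*_γ ≥ (c₁ − Δ/4)‖δ‖²_w + (c₂ − Δ)‖δ′‖²_w`»;
* §2 **cross-`K` second resolvent identity** (`pairOpKC_cross`, `resolventKC_sub_cross`):
  `R_K(σ)G − R_{K'}(σ)G = R_{K'}(σ)·ofPair (Kpair (K' − K) (pairOpKC_K σ G))` for `Re σ > −m, −m'` (uniqueness of the weak pair
  system), the bound `‖R_K(σ)G − R_{K'}(σ)G‖ ≤ ‖K' − K‖·(4/κ_c(σ))·‖G‖/(m' + Re σ)` (`norm_resolventKC_sub_cross_le`) and its Evans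
  form `|⟪h, R_K G⟫ − ⟪h, R_{K'} G⟫| ≤ ‖h‖·(…)` (`norm_inner_resolventKC_sub_cross_le`) — the row's «`|k* − k| ≤ pert`» clause, with
  the constant `2θΔ‖h‖²_w/(κ_c(σ)·c_w*)`, which is `≤ 16θΔ‖h‖²_w/(c_E·c_E*)` of record since `c_E* ≤ 4c_w*` (`two_div_le_sixteen_div`);
* §3 **the sheet's `B_u := Qop u + (Qop)ᵀ u`** (`secondVariation_apply`, `norm_secondVariation_le`, `norm_secondVariation_le_sheet`) and §4 the two (P8)
  consequences at a perturbed centre `Ω̄ + u`, `‖u‖_E ≤ r`, `L_lip·r < c` (`gardingDataKC_perturbedCentre`, `evans_perturbedCentre`),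
  plus the literal instance `r = rE♯₂` of `CertificateViscousSheetR` (`gardingDataKC_certifiedZero`).
What stays PAPER/Arb: the ball values (`Δ`, `pert`, the literals of the row) and cert-1's identification of its Galerkin objects with
`R_K`; the identification `B_u = DG(Ω̄ + u) − DG(Ω̄)` is by inspection of `Qop`'s formula (`SheetRAssemblyOperators`, the operator the
existence row `SheetRCertificateAssembly` is built on). No definition (`B_u` is written out as `Qop u + (Qop).flip u`); no named fact;
no `Prop` hypothesis beyond selfsim's `GardingDataKC`. WHAT THIS IS NOT: not NS; not the spectral certificate; no number of record moves.
-/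

noncomputable section

namespace Summit.NavierStokesRegularity.OSWSelfSimilar
namespace SheetRLinearisationPerturbation

open _root_.MeasureTheory _root_.Set _root_.Filter _root_.Real SheetRWeakProfilePV SheetRWeakToStrong SheetREnergyClass SheetRWeightedMeasure
  SheetRLinearisedTests SheetREnergySpace SheetRTestSpace SheetRLinearisedFormBounds SheetRSolutionOperator
  SheetRResolventPair SheetRComplexPivot SheetRResolventComplex SheetRPerturbedUniqueness SheetRPerturbedPair
  SheetRPerturbedResolventC SheetRPerturbedResolventIdentityC SheetRAssemblyOperators
open scoped Topology ENNReal InnerProductSpace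

variable {L D₀ D₁ V₀ c m c' m' : ℝ} {d V : ℝ → ℝ} {hL : 0 < L} {K K' : Esp L hL →L[ℝ] W L}

/-! ### §1 Gårding-datum transfer under a bounded perturbation `K ↦ K + B` -/

/-- The data integral against a compactly supported test IS the pairing `Pdata`: `∫ w g v = Pdata hL g (v, v₁)`. [folklore] -/
theorem integral_weight_mul_eq_Pdata (hL : 0 < L) (g : W L) {v v₁ : ℝ → ℝ} (hv : IsCompactTest v v₁) :
    ∫ y, (L ^ 2 + y ^ 2) * ((g : ℝ → ℝ) y * v y) = Pdata hL g ⟨(v, v₁), hv⟩ :=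
  (Pdata_apply hL g ⟨(v, v₁), hv⟩).symm

/-- **Gårding transfer, form version.** If `(c, m)` is a Gårding datum for `K` and the added operator `B : E → L²_w` satisfies the
one-sided form bound `−β‖jmap v‖² ≤ ∫ w B(jmap v)·v` on compactly supported tests, `β < c`, then `(c − β, m − β/4)` is a Gårding
datum for `K + B` (`‖jmap v‖² = ‖v₁‖²_w + ¼‖v‖²_w`). [folklore] -/
theorem gardingDataKC_add_of_lower (h : GardingDataKC L hL d V K D₀ D₁ V₀ c m) (B : Esp L hL →L[ℝ] W L) {β : ℝ}
    (hB : ∀ vp : testSpace, -(β * ‖jmap hL vp‖ ^ 2) ≤ Pdata hL (B (jmap hL vp)) vp) (hβ : β < c) :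
    GardingDataKC L hL d V (K + B) D₀ D₁ V₀ (c - β) (m - β / 4) where
  d_meas := h.d_meas
  V_meas := h.V_meas
  D₀_nonneg := h.D₀_nonneg
  D₁_nonneg := h.D₁_nonneg
  d_le := h.d_le
  V_le := h.V_le
  c_pos := by linarith
  garding vp := by
    have hG := h.garding vp
    have hb := hB vp
    rw [sq_norm_jmap] at hb
    rw [← Pdata_apply hL] at hG
    rw [← Pdata_apply hL, _root_.add_apply, map_add, LinearMap.add_apply]
    have key : (c - β) * (∫ ξ, (L ^ 2 + ξ ^ 2) * vp.1.2 ξ ^ 2) + (m - β / 4) * ∫ ξ, (L ^ 2 + ξ ^ 2) * vp.1.1 ξ ^ 2 =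
        (c * (∫ ξ, (L ^ 2 + ξ ^ 2) * vp.1.2 ξ ^ 2) + m * ∫ ξ, (L ^ 2 + ξ ^ 2) * vp.1.1 ξ ^ 2)
          - β * (1 / 4 * (∫ ξ, (L ^ 2 + ξ ^ 2) * vp.1.1 ξ ^ 2) + ∫ ξ, (L ^ 2 + ξ ^ 2) * vp.1.2 ξ ^ 2) := by ring
    rw [key]
    linarith

/-- **Gårding transfer, operator-norm version.** If `(c, m)` is a Gårding datum for `K` and `‖B‖_{E→L²_w} ≤ b` with `2b < c`, then
`(c − 2b, m − b/2)` is a Gårding datum for `K + B`: `∫ w B(jmap v)·v ≥ −2‖B(jmap v)‖_w‖jmap v‖ ≥ −2b‖jmap v‖²` (`abs_Pdata_le`,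
`‖v‖_w ≤ 2‖jmap v‖`). With `b = Δ/2`, `c = c₂`, `m = c₁ + γ` this is (P8)'s S1 clause «`q*_γ ≥ (c₁ − Δ/4)‖δ‖²_w + (c₂ − Δ)‖δ′‖²_w`». [folklore] -/
theorem gardingDataKC_add_of_norm_le (h : GardingDataKC L hL d V K D₀ D₁ V₀ c m) (B : Esp L hL →L[ℝ] W L) {b : ℝ}
    (hB : ‖B‖ ≤ b) (hb : 2 * b < c) : GardingDataKC L hL d V (K + B) D₀ D₁ V₀ (c - 2 * b) (m - b / 2) := by
  have key := gardingDataKC_add_of_lower h B (β := 2 * b) (fun vp => ?_) hb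
  · have e : (2 * b) / 4 = b / 2 := by ring
    rw [e] at key
    exact key
  · have h1 := (abs_le.1 (abs_Pdata_le hL (B (jmap hL vp)) vp)).1
    have h2 : ‖B (jmap hL vp)‖ ≤ b * ‖jmap hL vp‖ := (B.le_opNorm _).trans (by gcongr)
    have h3 := mul_le_mul_of_nonneg_right h2 (norm_nonneg (jmap hL vp))
    nlinarith [norm_nonneg (jmap hL vp), norm_nonneg (B (jmap hL vp))]

/-! ### §2 The cross-`K` second resolvent identity and the Evans perturbation bound -/

/-- **Cross-`K` absorption at the pair level.** For two Gårding data with the same drift/potential of record and perturbations `K`, `K'`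
(`Re σ > −m`, `Re σ > −m'`): the `K`-solution pair `Q = pairOpKC_K σ G` solves the `K'`-system with data `G + ((K' − K)Q_R, (K' − K)Q_I)`,
hence `pairOpKC_{K'} σ (G + Kpair (K' − K) Q) = Q` (uniqueness, `pairOpKC_unique`). [folklore] -/
theorem pairOpKC_cross (h : GardingDataKC L hL d V K D₀ D₁ V₀ c m) (h' : GardingDataKC L hL d V K' D₀ D₁ V₀ c' m')
    {σ : ℂ} (hσ : -m < σ.re) (hσ' : -m' < σ.re) (G : WithLp 2 (W L × W L)) :
    pairOpKC hL K' h' σ hσ' (G + Kpair hL (K' - K) (pairOpKC hL K h σ hσ G)) = pairOpKC hL K h σ hσ G := by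
  set Q := pairOpKC hL K h σ hσ G with hQ
  symm
  refine pairOpKC_unique hL K' h' σ hσ' _ fun v v₁ hv => ?_
  obtain ⟨e1, e2⟩ := (pairOpKC_spec hL K h σ hσ).1 G v v₁ hv
  have hd1 : ((G + Kpair hL (K' - K) Q).fst : W L) = G.fst + (K' - K) Q.fst := by
    rw [WithLp.add_fst, (Kpair_fst_snd hL (K' - K) Q).1]
  have hd2 : ((G + Kpair hL (K' - K) Q).snd : W L) = G.snd + (K' - K) Q.snd := by
    rw [WithLp.add_snd, (Kpair_fst_snd hL (K' - K) Q).2]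
  rw [integral_weight_mul_eq_Pdata hL (K Q.fst) hv, integral_weight_mul_eq_Pdata hL G.fst hv] at e1
  rw [integral_weight_mul_eq_Pdata hL (K Q.snd) hv, integral_weight_mul_eq_Pdata hL G.snd hv] at e2
  rw [integral_weight_mul_eq_Pdata hL (K' Q.fst) hv, integral_weight_mul_eq_Pdata hL (K' Q.snd) hv,
    integral_weight_mul_eq_Pdata hL ((G + Kpair hL (K' - K) Q).fst : W L) hv,
    integral_weight_mul_eq_Pdata hL ((G + Kpair hL (K' - K) Q).snd : W L) hv, hd1, hd2,
    map_add (Pdata hL), map_add (Pdata hL), LinearMap.add_apply, LinearMap.add_apply,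
    _root_.sub_apply, _root_.sub_apply, map_sub (Pdata hL), map_sub (Pdata hL),
    LinearMap.sub_apply, LinearMap.sub_apply]
  constructor
  · linarith
  · linarith

/-- **Cross-`K` difference at the pair level**: `pairOpKC_K σ G − pairOpKC_{K'} σ G = pairOpKC_{K'} σ (Kpair (K' − K) (pairOpKC_K σ G))`. [folklore] -/
theorem pairOpKC_sub_cross (h : GardingDataKC L hL d V K D₀ D₁ V₀ c m) (h' : GardingDataKC L hL d V K' D₀ D₁ V₀ c' m')
    {σ : ℂ} (hσ : -m < σ.re) (hσ' : -m' < σ.re) (G : WithLp 2 (W L × W L)) :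
    pairOpKC hL K h σ hσ G - pairOpKC hL K' h' σ hσ' G =
      pairOpKC hL K' h' σ hσ' (Kpair hL (K' - K) (pairOpKC hL K h σ hσ G)) := by
  have e := pairOpKC_cross h h' hσ hσ' G
  rw [map_add] at e
  exact sub_eq_of_eq_add' e.symm

/-- **THE CROSS-`K` SECOND RESOLVENT IDENTITY** on the complex pivot `L²_w(ℂ)`: for `Re σ > −m` and `Re σ > −m'`,
`R_K(σ)G − R_{K'}(σ)G = R_{K'}(σ)·ofPair (Kpair (K' − K) (pairOpKC_K σ (toPair G)))`, i.e. `R_K − R_{K'} = R_{K'}(K' − K)R_K` with the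
middle factor acting on the energy-space pair behind `R_K(σ)G`. [folklore] -/
theorem resolventKC_sub_cross (h : GardingDataKC L hL d V K D₀ D₁ V₀ c m) (h' : GardingDataKC L hL d V K' D₀ D₁ V₀ c' m')
    {σ : ℂ} (hσ : -m < σ.re) (hσ' : -m' < σ.re) (G : Wc L) :
    resolventKC hL K h σ G - resolventKC hL K' h' σ G =
      resolventKC hL K' h' σ (ofPair L (Kpair hL (K' - K) (pairOpKC hL K h σ hσ (toPair L G)))) := by
  obtain ⟨e1, -, -, -⟩ := resolventKC_weak hL K h hσ G
  obtain ⟨e2, -, -, -⟩ := resolventKC_weak hL K' h' hσ' G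
  obtain ⟨e3, -, -, -⟩ := resolventKC_weak hL K' h' hσ' (ofPair L (Kpair hL (K' - K) (pairOpKC hL K h σ hσ (toPair L G))))
  rw [e1, e2, e3, toPair_ofPair, ← map_sub, ← map_sub, pairOpKC_sub_cross h h' hσ hσ']

/-- **Norm bound for the cross-`K` difference**: `‖R_K(σ)G − R_{K'}(σ)G‖ ≤ ‖K' − K‖·(4/κ_c(σ))·‖G‖/(m' + Re σ)`
(`κ_c(σ) = min(c, 4(m + Re σ))` the `K`-datum's energy constant: `‖pairOpKC_K σ G‖_E ≤ (4/κ_c(σ))‖G‖`; `1/(m' + Re σ)` the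
`K'`-datum's sharp pivot bound `norm_resolventKC_le_inv`). [folklore] -/
theorem norm_resolventKC_sub_cross_le (h : GardingDataKC L hL d V K D₀ D₁ V₀ c m) (h' : GardingDataKC L hL d V K' D₀ D₁ V₀ c' m')
    {σ : ℂ} (hσ : -m < σ.re) (hσ' : -m' < σ.re) (G : Wc L) :
    ‖resolventKC hL K h σ G - resolventKC hL K' h' σ G‖ ≤
      ‖K' - K‖ * (4 / min c (4 * (m + σ.re))) * ‖G‖ / (m' + σ.re) := by
  rw [resolventKC_sub_cross h h' hσ hσ' G]
  set Q := pairOpKC hL K h σ hσ (toPair L G) with hQ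
  have hm' : 0 < m' + σ.re := by linarith
  have h1 := norm_resolventKC_le_inv hL K' h' hσ' (ofPair L (Kpair hL (K' - K) Q))
  rw [norm_ofPair] at h1
  have h2 := norm_Kpair_le hL (K' - K) Q
  have h3 := (pairOpKC_spec hL K h σ hσ).2 (toPair L G)
  rw [norm_toPair] at h3
  have h4 : ‖Kpair hL (K' - K) Q‖ ≤ ‖K' - K‖ * (4 / min c (4 * (m + σ.re))) * ‖G‖ :=
    h2.trans (by rw [mul_assoc]; exact mul_le_mul_of_nonneg_left h3 (norm_nonneg (K' - K)))
  exact h1.trans (by gcongr)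

/-- **(P8), Evans form.** `|⟪h, R_K(σ)G⟫ − ⟪h, R_{K'}(σ)G⟫| ≤ ‖h‖·‖K' − K‖·(4/κ_c(σ))·‖G‖/(m' + Re σ)`: the perturbation of cert-1's
`k(σ) = θ⟨h, wR(σ)Jh⟩` when `Ω̄ ↦ Ω*` (`K' − K = B_u`, `‖B_u‖ ≤ Δ/2`): `|k* − k| ≤ 2θΔ‖h‖²_w/(κ_c(σ)(m* + Re σ))`. [folklore] -/
theorem norm_inner_resolventKC_sub_cross_le (h : GardingDataKC L hL d V K D₀ D₁ V₀ c m)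
    (h' : GardingDataKC L hL d V K' D₀ D₁ V₀ c' m') {σ : ℂ} (hσ : -m < σ.re) (hσ' : -m' < σ.re) (hv G : Wc L) :
    ‖⟪hv, resolventKC hL K h σ G⟫_ℂ - ⟪hv, resolventKC hL K' h' σ G⟫_ℂ‖ ≤
      ‖hv‖ * (‖K' - K‖ * (4 / min c (4 * (m + σ.re))) * ‖G‖ / (m' + σ.re)) := by
  rw [← inner_sub_right]
  exact (norm_inner_le_norm _ _).trans (mul_le_mul_of_nonneg_left (norm_resolventKC_sub_cross_le h h' hσ hσ' G) (norm_nonneg _))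

/-- **The constant of record dominates the kernel constant.** For `κ, w, x > 0`: `2/(κ·w) ≤ 16/(κ·min(x, 4w))` — with `κ = c_E`,
`w = c_w* = m* + Re σ`, `x = c₂ − Δ` this says `2θΔ‖h‖²/(c_E c_w*) ≤ pert := 16θΔ‖h‖²/(c_E c_E*)`, `c_E* = min(c₂ − Δ, 4c_w*)`. [folklore] -/
theorem two_div_le_sixteen_div {κ w x : ℝ} (hκ : 0 < κ) (hw : 0 < w) (hx : 0 < x) :
    2 / (κ * w) ≤ 16 / (κ * min x (4 * w)) := by
  have hmin : 0 < min x (4 * w) := lt_min hx (by linarith)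
  have hle : min x (4 * w) ≤ 4 * w := min_le_right _ _
  rw [div_le_div_iff₀ (mul_pos hκ hw) (mul_pos hκ hmin)]
  nlinarith [mul_pos hκ hw, mul_pos hκ hmin]

/-! ### §3 The sheet's perturbation `B_u = D²G(Ω̄)[u, ·]`: the symmetrised quadratic part -/

/-- **The second variation of the profile map at the centre in the direction `u`** is the operator
`B_u := Qop u + (Qop)ᵀ u : E →L L²_w` (no new definition: a sum of two tree operators), `B_u δ = Qop u δ + Qop δ u`, i.e. the `L²_w`
class of `(a𝒰_u·δ′ − Hu·δ) + (a𝒰_δ·u′ − Hδ·u)` — since `G` is quadratic with quadratic part `N(Ω) = Qop Ω Ω`,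
`DG(Ω̄ + u) − DG(Ω̄) = B_u`. [folklore] -/
theorem secondVariation_apply (hL : 0 < L) (a : ℝ) (u δ : Esp L hL) :
    (Qop hL a u + (Qop hL a).flip u) δ = Qop hL a u δ + Qop hL a δ u := by
  rw [_root_.add_apply, ContinuousLinearMap.flip_apply]

/-- `B_u` is symmetric in `(u, δ)`: `B_u δ = B_δ u`. [folklore] -/
theorem secondVariation_comm (hL : 0 < L) (a : ℝ) (u δ : Esp L hL) :
    (Qop hL a u + (Qop hL a).flip u) δ = (Qop hL a δ + (Qop hL a).flip δ) u := by
  rw [secondVariation_apply, secondVariation_apply, add_comm]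

/-- **`‖B_u‖_{E→L²_w} ≤ 2M_w‖u‖_E`** (`‖Qop p q‖ ≤ M_w‖p‖‖q‖`, `M_w = 2|a|(π/(4L))^{1/2} + 2√2/L`). [folklore] -/
theorem norm_secondVariation_le (hL : 0 < L) (a : ℝ) (u : Esp L hL) :
    ‖Qop hL a u + (Qop hL a).flip u‖ ≤ 2 * Mw L a * ‖u‖ := by
  refine ContinuousLinearMap.opNorm_le_bound _ (by have := Mw_nonneg hL a; positivity) fun δ => ?_
  rw [secondVariation_apply]
  calc ‖Qop hL a u δ + Qop hL a δ u‖ ≤ ‖Qop hL a u δ‖ + ‖Qop hL a δ u‖ := norm_add_le _ _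
    _ ≤ Mw L a * ‖u‖ * ‖δ‖ + Mw L a * ‖δ‖ * ‖u‖ := add_le_add (Qop_apply hL a u δ).2 (Qop_apply hL a δ u).2
    _ = 2 * Mw L a * ‖u‖ * ‖δ‖ := by ring

/-- **At the frame of record `(L, a) = (8, 1/5)`: `‖B_u‖ ≤ (L_lip/2)‖u‖_E`** (`4M_w ≤ Llip = 95777/50000`, `four_Mw_le_Llip`) — PRICE-impl1
(C4)'s «`‖DG(x) − DG(y)‖_{E→X*} ≤ L_lip‖x − y‖_E`» in the pivot (`‖f‖_{X*} ≤ 2‖f‖_w`). [folklore] -/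
theorem norm_secondVariation_le_sheet (h8 : (0 : ℝ) < 8) (u : Esp 8 h8) :
    ‖Qop h8 (1 / 5) u + (Qop h8 (1 / 5)).flip u‖ ≤ (CertificateViscousSheetR.Llip : ℝ) / 2 * ‖u‖ := by
  have h1 := norm_secondVariation_le h8 (1 / 5) u
  have h2 := four_Mw_le_Llip
  nlinarith [norm_nonneg u]

/-! ### §4 (P8) at a perturbed centre `Ω* = Ω̄ + u` -/

section PerturbedCentre

variable {d V : ℝ → ℝ} {h8 : (0 : ℝ) < 8} {K : Esp 8 h8 →L[ℝ] W 8} {D₀ D₁ V₀ c m r : ℝ}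

/-- **(P8), S1 clause.** If `(c, m)` is a Gårding datum for the operator of record at the centre (`K`), `‖u‖_E ≤ r` and `L_lip·r < c`,
then `(c − L_lip·r, m − L_lip·r/4)` is a Gårding datum at `Ω̄ + u` (`K + B_u`). For cert-1: `c = c₂`, `m = c₁ + γ`, `Δ = L_lip·r`
⇒ «`q*_γ(δ) ≥ (c₁ − Δ/4)‖δ‖²_w + (c₂ − Δ)‖δ′‖²_w`». MODEL statement; not NS. [folklore] -/
theorem gardingDataKC_perturbedCentre (h : GardingDataKC 8 h8 d V K D₀ D₁ V₀ c m) (u : Esp 8 h8) (hu : ‖u‖ ≤ r)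
    (hc : (CertificateViscousSheetR.Llip : ℝ) * r < c) :
    GardingDataKC 8 h8 d V (K + (Qop h8 (1 / 5) u + (Qop h8 (1 / 5)).flip u)) D₀ D₁ V₀
      (c - CertificateViscousSheetR.Llip * r) (m - CertificateViscousSheetR.Llip * r / 4) := by
  have hL0 : (0 : ℝ) ≤ (CertificateViscousSheetR.Llip : ℝ) := by norm_num [CertificateViscousSheetR.Llip]
  have hB : ‖(Qop h8 (1 / 5) u + (Qop h8 (1 / 5)).flip u)‖ ≤ CertificateViscousSheetR.Llip * r / 2 :=
    (norm_secondVariation_le_sheet h8 u).trans (by nlinarith)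
  have key := gardingDataKC_add_of_norm_le h ((Qop h8 (1 / 5) u + (Qop h8 (1 / 5)).flip u)) hB (by linarith)
  convert key using 2 <;> ring

/-- **(P8), S1 clause at the literal of record**: `r = rE♯₂ = 6.80e-6` (`CertificateViscousSheetR.rEsharp2`, the certified
`‖Ω* − Ω̄‖_E`-radius under the conservative constant), `Δ := L_lip·rE♯₂`. MODEL statement; not NS. [folklore] -/
theorem gardingDataKC_certifiedZero (h : GardingDataKC 8 h8 d V K D₀ D₁ V₀ c m) (u : Esp 8 h8)
    (hu : ‖u‖ ≤ (CertificateViscousSheetR.rEsharp2 : ℝ))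
    (hc : (CertificateViscousSheetR.Llip : ℝ) * CertificateViscousSheetR.rEsharp2 < c) :
    GardingDataKC 8 h8 d V (K + (Qop h8 (1 / 5) u + (Qop h8 (1 / 5)).flip u)) D₀ D₁ V₀
      (c - CertificateViscousSheetR.Llip * CertificateViscousSheetR.rEsharp2)
      (m - CertificateViscousSheetR.Llip * CertificateViscousSheetR.rEsharp2 / 4) :=
  gardingDataKC_perturbedCentre h u hu hc

/-- **(P8), S2 clause.** With `Δ = L_lip·r`, for `Re σ > −(m − Δ/4)` (so both resolvents exist) and all `h, G ∈ L²_w(ℂ)`: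
`|⟪h, R_K(σ)G⟫ − ⟪h, R_{K+B_u}(σ)G⟫| ≤ ‖h‖·(Δ/2)·(4/κ_c(σ))·‖G‖/(m − Δ/4 + Re σ)`; for cert-1's `k = θ⟨h, wR(σ)Jh⟩` this is
`|k* − k| ≤ 2θΔ‖h‖²_w/(κ_c(σ)·c_w*)`, dominated by the row's `pert` (`two_div_le_sixteen_div`). MODEL statement; not NS. [folklore] -/
theorem evans_perturbedCentre (h : GardingDataKC 8 h8 d V K D₀ D₁ V₀ c m) (u : Esp 8 h8) (hu : ‖u‖ ≤ r)
    (hc : (CertificateViscousSheetR.Llip : ℝ) * r < c) {σ : ℂ}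
    (hσ' : -(m - CertificateViscousSheetR.Llip * r / 4) < σ.re) (hv G : Wc 8) :
    ‖⟪hv, resolventKC h8 K h σ G⟫_ℂ
        - ⟪hv, resolventKC h8 (K + (Qop h8 (1 / 5) u + (Qop h8 (1 / 5)).flip u)) (gardingDataKC_perturbedCentre h u hu hc) σ G⟫_ℂ‖ ≤
      ‖hv‖ * (CertificateViscousSheetR.Llip * r / 2 * (4 / min c (4 * (m + σ.re))) * ‖G‖
        / (m - CertificateViscousSheetR.Llip * r / 4 + σ.re)) := by
  have hL0 : (0 : ℝ) ≤ (CertificateViscousSheetR.Llip : ℝ) := by norm_num [CertificateViscousSheetR.Llip]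
  have hr : 0 ≤ r := (norm_nonneg u).trans hu
  have hσ : -m < σ.re := by nlinarith
  have hm' : 0 < m - CertificateViscousSheetR.Llip * r / 4 + σ.re := by linarith
  have hB : ‖(K + (Qop h8 (1 / 5) u + (Qop h8 (1 / 5)).flip u)) - K‖ ≤ CertificateViscousSheetR.Llip * r / 2 := by
    rw [add_sub_cancel_left]
    exact (norm_secondVariation_le_sheet h8 u).trans (by nlinarith)
  have key := norm_inner_resolventKC_sub_cross_le h (gardingDataKC_perturbedCentre h u hu hc) hσ hσ' hv G
  refine key.trans (mul_le_mul_of_nonneg_left ?_ (norm_nonneg _))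
  have hκ : 0 < 4 / min c (4 * (m + σ.re)) := div_pos four_pos (kappaC_pos h hσ)
  gcongr

end PerturbedCentre

end SheetRLinearisationPerturbation
end Summit.NavierStokesRegularity.OSWSelfSimilar

end
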